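import Mathlib
import HarnessLib
import Summits.NavierStokesRegularity.Statement
import Summits.NavierStokesRegularity.NavierStokesRegularity.Theses.ConservativeEngine
import Summits.NavierStokesRegularity.NavierStokesRegularity.Theorems.ConservativeEngineExtinctRung

/-!
# BC5 WITNESS OF WEAKNESS for N30's deciding crux X_Eᶜ⁻ =
# `ConservativeEngine.ConservativePowerGaugeEulerLiouvilleInterior` (stmt-NavierStokesRegularity-28361)
# — decomp-ns route-writer g10, 2026-08-30.  DEF-FREE, binder shape, 0 sorry.  Lands as
# `Theorems/ConservativeEngineExtinctInteriorRung.lean --supports stmt-NavierStokesRegularity-28361 --as helper`.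

After the W3 «ATOM SWAP» edit (route rev 4, commit 751b032b) the DECIDING crux of route `ConservativeEngine` is the
INTERIOR engine X_Eᶜ⁻ (stmt-28361 = stmt-27529's text with the extra binder `ρ < 1/2`); the tribunal kernel of record
(ts 2026-08-30T17:39:43Z) was computed on the OLD cone and reports `t3:absent`.  The BC5 rung landed for 27529
(`Theorems.ConservativeEngine.ExtinctRung.conservativePowerGaugeEulerLiouville_extinctRung`, p783144: window
`2/9 < ρ ≤ 1/2`, energy-EXTINCT members of Seregin's conservative power-gauged ancient Euler class vanish) restricts
VERBATIM to the interior window `2/9 < ρ < 1/2`, which is a stratum OF THE NEW CRUX.  This file spells that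
restriction out in 28361's OWN binder shape (its hypotheses verbatim, plus the window and the extinction hypothesis):

* `conservativePowerGaugeEulerLiouvilleInterior_extinctRung`     — the interior rung HOLDS (0 sorry; = the landed rung
                                                                    at `ρ ≤ 1/2` weakened to `ρ < 1/2`);
* `conservativePowerGaugeEulerLiouvilleInterior_extinctRung_of`  — the rung is a RESTRICTION of the crux
                                                                    (X_Eᶜ⁻ ⇒ rung, pure logic).

WHY IT IS A WITNESS (T3) — unchanged from the 27529 rung: the proof USES the route's lever (the local energy EQUALITY,
run against a cut-off of a large ball over the final window, with the landed window-flux bound `≤ M a^{1/2−9ρ/4} → 0`,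
whence `2/9`), it decides a stratum of the crux's class whose NS-side image through the PROVED conservative zoom
`ConservativeZoomReduction` (stmt-27530, closed) is not a theorem in print, and it is STRICTLY WEAKER than the crux (the
persistent stratum and the window `0 < ρ ≤ 2/9` stay open).  No summit, crux or stub is proved here.
-/

noncomputable section

set_option linter.dupNamespace false
set_option linter.unusedVariables false

namespace Summit.NavierStokesRegularity.NavierStokesRegularity.Theorems.ConservativeEngine.ExtinctInteriorRung

open scoped Topology ENNReal NNReal RealInnerProductSpace
open Filter Set MeasureTheory Metric Function
open Literature.Analysis Literature.Analysis.FluidPDE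

/-- **BC5 rung for X_Eᶜ⁻ (stmt-28361) — HOLDS (0 sorry).**  28361's binders VERBATIM, restricted to the interior window
`2/9 < ρ < 1/2` and to energy-EXTINCT members (`∫_{B_a}|u(τ)|² → 0` as `τ → 0⁻`, every `a`): such a flow vanishes a.e.
Proof: the landed rung `ExtinctRung.conservativePowerGaugeEulerLiouville_extinctRung` at `ρ ≤ 1/2`. -/
theorem conservativePowerGaugeEulerLiouvilleInterior_extinctRung :
    ∀ ρ : ℝ, 2 / 9 < ρ → ρ < 1 / 2 →
    ∀ (u : ℝ → EuclideanSpace ℝ (Fin 3) → EuclideanSpace ℝ (Fin 3)) (p : ℝ → EuclideanSpace ℝ (Fin 3) → ℝ)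
      (H : ℝ → EuclideanSpace ℝ (Fin 3) → EuclideanSpace ℝ (Fin 3) →L[ℝ] EuclideanSpace ℝ (Fin 3)) (c : NNReal),
      IsSuitableWeakSolutionOn (slab (EuclideanSpace ℝ (Fin 3)) (Set.Iio 0) isOpen_Iio) 0 0 u p →
      HasWeakSpatialGradientOn (slab (EuclideanSpace ℝ (Fin 3)) (Set.Iio 0) isOpen_Iio) u H →
      (∀ a : ℝ, 0 < a →
        ENNReal.ofReal (a ^ (2 * ρ)) * cknA a (0 : ℝ × EuclideanSpace ℝ (Fin 3)) u +
            ENNReal.ofReal (a ^ ρ) * cknE a (0 : ℝ × EuclideanSpace ℝ (Fin 3)) H +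
          ENNReal.ofReal (a ^ (2 * ρ)) * cknD a (0 : ℝ × EuclideanSpace ℝ (Fin 3)) p ≤ (c : ℝ≥0∞)) →
      (∀ φ : ℝ → EuclideanSpace ℝ (Fin 3) → ℝ,
        IsSpaceTimeTestOn (slab (EuclideanSpace ℝ (Fin 3)) (Set.Iio 0) isOpen_Iio) φ →
        ∫ t, ∫ x, (‖u t x‖ ^ 2 * timeDeriv φ t x + (‖u t x‖ ^ 2 + 2 * p t x) * inner ℝ (u t x) (gradient (φ t) x)) = 0) →
      (∀ a : ℝ, 0 < a →
        Tendsto (fun τ : ℝ => ∫⁻ x in Metric.ball (0 : EuclideanSpace ℝ (Fin 3)) a, ‖u τ x‖ₑ ^ 2)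
          (𝓝[<] (0 : ℝ)) (𝓝 0)) →
      Function.uncurry u =ᵐ[volume.restrict (Set.Iio (0 : ℝ) ×ˢ (Set.univ : Set (EuclideanSpace ℝ (Fin 3))))] 0 := by
  intro ρ h1 h2 u p H c hsw hH hc hcons hext
  exact Summit.NavierStokesRegularity.NavierStokesRegularity.Theorems.ConservativeEngine.ExtinctRung.conservativePowerGaugeEulerLiouville_extinctRung
    ρ h1 (le_of_lt h2) u p H c hsw hH hc hcons hext

/-- The interior rung is a RESTRICTION of N30's deciding crux X_Eᶜ⁻ (stmt-28361): crux ⇒ rung, pure logic (the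
extinction hypothesis is simply dropped and the window `2/9 < ρ` weakened to `0 < ρ`). -/
theorem conservativePowerGaugeEulerLiouvilleInterior_extinctRung_of
    (h : Summit.NavierStokesRegularity.NavierStokesRegularity.Theses.ConservativeEngine.ConservativePowerGaugeEulerLiouvilleInterior) :
    ∀ ρ : ℝ, 2 / 9 < ρ → ρ < 1 / 2 →
    ∀ (u : ℝ → EuclideanSpace ℝ (Fin 3) → EuclideanSpace ℝ (Fin 3)) (p : ℝ → EuclideanSpace ℝ (Fin 3) → ℝ)
      (H : ℝ → EuclideanSpace ℝ (Fin 3) → EuclideanSpace ℝ (Fin 3) →L[ℝ] EuclideanSpace ℝ (Fin 3)) (c : NNReal),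
      IsSuitableWeakSolutionOn (slab (EuclideanSpace ℝ (Fin 3)) (Set.Iio 0) isOpen_Iio) 0 0 u p →
      HasWeakSpatialGradientOn (slab (EuclideanSpace ℝ (Fin 3)) (Set.Iio 0) isOpen_Iio) u H →
      (∀ a : ℝ, 0 < a →
        ENNReal.ofReal (a ^ (2 * ρ)) * cknA a (0 : ℝ × EuclideanSpace ℝ (Fin 3)) u +
            ENNReal.ofReal (a ^ ρ) * cknE a (0 : ℝ × EuclideanSpace ℝ (Fin 3)) H +
          ENNReal.ofReal (a ^ (2 * ρ)) * cknD a (0 : ℝ × EuclideanSpace ℝ (Fin 3)) p ≤ (c : ℝ≥0∞)) →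
      (∀ φ : ℝ → EuclideanSpace ℝ (Fin 3) → ℝ,
        IsSpaceTimeTestOn (slab (EuclideanSpace ℝ (Fin 3)) (Set.Iio 0) isOpen_Iio) φ →
        ∫ t, ∫ x, (‖u t x‖ ^ 2 * timeDeriv φ t x + (‖u t x‖ ^ 2 + 2 * p t x) * inner ℝ (u t x) (gradient (φ t) x)) = 0) →
      (∀ a : ℝ, 0 < a →
        Tendsto (fun τ : ℝ => ∫⁻ x in Metric.ball (0 : EuclideanSpace ℝ (Fin 3)) a, ‖u τ x‖ₑ ^ 2)
          (𝓝[<] (0 : ℝ)) (𝓝 0)) →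
      Function.uncurry u =ᵐ[volume.restrict (Set.Iio (0 : ℝ) ×ˢ (Set.univ : Set (EuclideanSpace ℝ (Fin 3))))] 0 :=
  fun ρ h1 h2 u p H c hsw hH hc hcons _hext => h ρ (by linarith) h2 u p H c hsw hH hc hcons

/-- The landed 27529-rung at `ρ ≤ 1/2` implies the interior rung (informational; the interior window is a sub-window). -/
theorem extinctRung_interior_of_extinctRung
    (h : Summit.NavierStokesRegularity.NavierStokesRegularity.Theorems.ConservativeEngine.ExtinctRung.ExtinctRung) :
    ∀ ρ : ℝ, 2 / 9 < ρ → ρ < 1 / 2 →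
    ∀ (u : ℝ → EuclideanSpace ℝ (Fin 3) → EuclideanSpace ℝ (Fin 3)) (p : ℝ → EuclideanSpace ℝ (Fin 3) → ℝ)
      (H : ℝ → EuclideanSpace ℝ (Fin 3) → EuclideanSpace ℝ (Fin 3) →L[ℝ] EuclideanSpace ℝ (Fin 3)) (c : NNReal),
      IsSuitableWeakSolutionOn (slab (EuclideanSpace ℝ (Fin 3)) (Set.Iio 0) isOpen_Iio) 0 0 u p →
      HasWeakSpatialGradientOn (slab (EuclideanSpace ℝ (Fin 3)) (Set.Iio 0) isOpen_Iio) u H →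
      (∀ a : ℝ, 0 < a →
        ENNReal.ofReal (a ^ (2 * ρ)) * cknA a (0 : ℝ × EuclideanSpace ℝ (Fin 3)) u +
            ENNReal.ofReal (a ^ ρ) * cknE a (0 : ℝ × EuclideanSpace ℝ (Fin 3)) H +
          ENNReal.ofReal (a ^ (2 * ρ)) * cknD a (0 : ℝ × EuclideanSpace ℝ (Fin 3)) p ≤ (c : ℝ≥0∞)) →
      (∀ φ : ℝ → EuclideanSpace ℝ (Fin 3) → ℝ,
        IsSpaceTimeTestOn (slab (EuclideanSpace ℝ (Fin 3)) (Set.Iio 0) isOpen_Iio) φ →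
        ∫ t, ∫ x, (‖u t x‖ ^ 2 * timeDeriv φ t x + (‖u t x‖ ^ 2 + 2 * p t x) * inner ℝ (u t x) (gradient (φ t) x)) = 0) →
      (∀ a : ℝ, 0 < a →
        Tendsto (fun τ : ℝ => ∫⁻ x in Metric.ball (0 : EuclideanSpace ℝ (Fin 3)) a, ‖u τ x‖ₑ ^ 2)
          (𝓝[<] (0 : ℝ)) (𝓝 0)) →
      Function.uncurry u =ᵐ[volume.restrict (Set.Iio (0 : ℝ) ×ˢ (Set.univ : Set (EuclideanSpace ℝ (Fin 3))))] 0 :=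
  fun ρ h1 h2 u p H c hsw hH hc hcons hext => h ρ h1 (le_of_lt h2) u p H c hsw hH hc hcons hext

end Summit.NavierStokesRegularity.NavierStokesRegularity.Theorems.ConservativeEngine.ExtinctInteriorRung
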